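import Mathlib
import Literature.NumberTheory.Irrationality.Brown2016.DinnerParties
import HarnessLib

/-!
# ζ(5) search — Families: Brown's generalised cellular integral of an ARBITRARY configuration, in simplicial coordinates

HONEST FRAMING: systematic search; no irrationality claim unless certified.

Cell `pub-zeta5`, seat P2 (Lean support for the family designers `fam-brown8` / `fam-brown9` / `fam-rv`).  This file
contains NO statement about zeta values: it fixes, once for every seating plan `σ ∈ S_n` (`n = ℓ + 3 ≥ 5` marked points,
`ℓ` simplicial coordinates), the objects of F. Brown, *Irrationality proofs for zeta values, moduli spaces and dinner
parties*, arXiv:1412.6508 [Brown2016], §1.5 and §5.1–5.2, written out in the simplicial coordinates of [Brown2016, §1.5,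
§3.2]: "substituting `(0, t₁, …, t_ℓ, 1, ∞)` for `(z₁, …, z_n)` and formally omitting … all factors equal to `∞`".

* `pt t k` — the finite marked points `z₁ = 0, z₂ = t₁, …, z_{n−2} = t_ℓ, z_{n−1} = 1` (index `k = 0, …, ℓ+1`, 0-based);
  the vertex `ℓ + 2` is Brown's `z_n = ∞`.
* `ef t u v` — the edge factor `z_u − z_v` oriented as (larger index) − (smaller index), so that it is POSITIVE on the
  simplex (`ef_pos`), and `= 1` when `u` or `v` is the point at infinity (the omitted factors).
* `integrand σ a b t` — the generalised cellular integrand `f_σ(a,b) ω_σ` of [Brown2016, §1.5 display before (1.6); §5.2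
  eq. (5.4)]: `∏_i (z_i − z_{i+1})^{a_i} / ∏_i (z_{σ_i} − z_{σ_{i+1}})^{b_i}` times the cellular form
  `ω_σ = dt / ∏_i (z_{σ_i} − z_{σ_{i+1}})` [Brown2016, §3.2 (simplicial form of `ω_δ`)]; exponents `a i = a_{i,i+1}` on the
  edges of the standard polygon `δ⁰` and `b i = b_{σ_i, σ_{i+1}}` on the edges of `σδ⁰`, both indexed by POSITION `i ∈ ℤ/n`.
* `openSimplex ℓ` — `0 < t₁ < ⋯ < t_ℓ < 1`; `integral σ a b = ∫_{openSimplex} integrand` (Bochner; junk `0` if not integrable).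
* `Homogeneous σ a b` — Brown's homogeneity equations [Brown2016, §5.1 eq. (5.2)]
  `a_{σ_i − 1, σ_i} + a_{σ_i, σ_i + 1} = b_{σ_{i−1}, σ_i} + b_{σ_i, σ_{i+1}}` (all `i mod n`), under which the integrand
  descends to `M_{0,n}`; `basic σ N` = all exponents `N` (the basic cellular integral `I_σ(N)` [Brown2016, §1.5 (1.3)]).
* `twoOrd σ a b p k` — TWICE the order of vanishing of `f_σ(a,b) ω_σ` along the boundary divisor `D = D_{S|T}` at finite
  distance, `S = {p, p+1, …, p+k−1} (mod n)`, computed by Brown's valuation calculus [Brown2016, §3.4 eq. (3.8) with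
  `𝕀_D(i,j) = ½(𝟙({i,j} ⊆ S) + 𝟙({i,j} ⊆ T))`, and Lemma 3.11 `ord_D ω_σ = (ℓ−1)/2 − 𝕀_D(σ)`]:
  `2 v_D = Σ_i a_i c_D(i,i+1) − Σ_i (b_i + 1) c_D(σ_i,σ_{i+1}) + (ℓ − 1)`, `c_D(u,v) = 1` if the chord `D` does not separate
  `u` from `v`, else `0` (`sameSide`).
* `BrownConvergent σ a b` — the COMBINATORIAL convergence condition "no poles along divisors at finite distance with respect
  to `δ⁰`" [Brown2016, §2.4 eq. (2.3), Def. 5.1]: `0 ≤ twoOrd σ a b p k` for all `p` and `2 ≤ k ≤ n − 2`.  It is a decidable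
  predicate on the exponents; its identification with BZ's seventeen linear forms for `₈π₈^∨` is PROVED in
  `Families/CellularBrownZudilin.lean`.  (That `BrownConvergent` is equivalent to integrability of `integrand` is Brown's
  analytic statement [Brown2016, §2.4, Lemma 3.6, Def. 5.1]; it is NOT asserted here.)

PROVED here (all `σ`, all exponents): positivity of every edge factor and of the integrand on the open simplex
(`ef_pos`, `integrand_pos`, for `σ` injective), `integral_nonneg`, `integral_pos` (given integrability), openness and
measurability of the simplex, the power form of the basic integrand (`basic_eq`); and `ofSeating`, converting the printed
1-based seating lists of `Brown2016.DinnerParties` into maps `Fin n → Fin n`.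

Second implementation of the valuation calculus (symbolic, Python): cell HOME `code/p2/cellular_forms.py` (reproduces
[BrownZudilin2022, (3)] exactly: the 40 rows for `₈π₈^∨` are BZ's 17 forms plus `a₁+a₂+1, a₄+a₅+1, a₂+a₃+a₆−a₈+1`).

RECIPE (for a designer's configuration `σ : Fin n → Fin n`, `n = ℓ + 3`, exponents `A B : Fin n → ℤ` given by `![…]`
vectors of linear forms in the parameters): the convergence polytope is obtained as an explicit conjunction by
`unfold BrownConvergent twoOrd; dsimp only [Nat.reduceAdd]; simp only [forall_finN, forall_finℓ, Fin.sum_univ_N];`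
`simp [sameSide, σ, A, B]` (then `omega` closes any claimed equivalent description); the integrand as an explicit rational
function by `simp [integrand, num, den, formDen, Fin.prod_univ_N, σ, A, B, ef, pt, max_def, min_def]`; homogeneity by
`intro i; fin_cases i <;> simp [σ, A, B] <;> ring`.  Worked instances: `Families/CellularBrownZudilin.lean` (`₈π₈^∨`),
`Families/CellularVanishingMiddle.lean` (`(10,2,4,1,6,3,8,5,9,7)`), `Families/CellularBrownExamples.lean` (`N = 5, 6`, `₈π₈`).
-/

noncomputable section

open MeasureTheory Finset Set

namespace Summit.KontsevichZagierPeriods.Zeta5Search.Families.Cellular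

variable {ℓ : ℕ}

/-! ### Marked points and edge factors in simplicial coordinates -/

/-- The finite marked points in simplicial coordinates, 0-based: `pt t 0 = 0` (`z₁`), `pt t k = t_{k}` i.e. `t ⟨k−1,_⟩`
for `1 ≤ k ≤ ℓ` (`z₂,…,z_{ℓ+1}`), and `pt t k = 1` for `k ≥ ℓ + 1` (`z_{n−1} = 1`; the value at the index `ℓ+2` of the
point at infinity is never used). [Brown2016, §1.5 "substituting `(0,t₁,…,t_ℓ,1,∞)` for `(z₁,…,z_n)`"] -/
def pt (t : Fin ℓ → ℝ) (k : ℕ) : ℝ :=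
  if k = 0 then 0 else if h : k - 1 < ℓ then t ⟨k - 1, h⟩ else 1

/-- The edge factor attached to the unordered pair of vertices `{u, v}` (0-based indices in `Fin (ℓ+3)`): `1` if one of
them is the point at infinity `ℓ + 2` ("formally omitting all factors equal to `∞`"), otherwise the difference of the two
marked points oriented as larger index minus smaller index (positive on the simplex). [Brown2016, §1.5] -/
def ef (t : Fin ℓ → ℝ) (u v : Fin (ℓ + 3)) : ℝ :=
  if u.val = ℓ + 2 ∨ v.val = ℓ + 2 then 1 else pt t (max u.val v.val) - pt t (min u.val v.val)

/-- The open simplex `0 < t₁ < t₂ < ⋯ < t_ℓ < 1`, i.e. `pt t 0 < pt t 1 < ⋯ < pt t (ℓ+1)`.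
[Brown2016, §2.3 (the cell `X_{δ⁰}` in simplicial coordinates)] -/
def openSimplex (ℓ : ℕ) : Set (Fin ℓ → ℝ) :=
  {t | ∀ k : Fin (ℓ + 1), pt t k < pt t (k + 1)}

/-! ### The generalised cellular integrand and integral -/

/-- Numerator `∏_{i ∈ ℤ/n} (z_i − z_{i+1})^{a_i}` (edges of the standard polygon `δ⁰`, exponent indexed by the position
`i` of the edge `{i, i+1}`; integer powers). [Brown2016, §5.2 eq. (5.4)] -/
def num (a : Fin (ℓ + 3) → ℤ) (t : Fin ℓ → ℝ) : ℝ :=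
  ∏ i : Fin (ℓ + 3), ef t i (i + 1) ^ (a i)

/-- Denominator `∏_{i ∈ ℤ/n} (z_{σ_i} − z_{σ_{i+1}})^{b_i}` (edges of the polygon `σδ⁰`, exponent indexed by the position
`i` of the edge `{σ_i, σ_{i+1}}`). [Brown2016, §5.2 eq. (5.4)] -/
def den (σ : Fin (ℓ + 3) → Fin (ℓ + 3)) (b : Fin (ℓ + 3) → ℤ) (t : Fin ℓ → ℝ) : ℝ :=
  ∏ i : Fin (ℓ + 3), ef t (σ i) (σ (i + 1)) ^ (b i)

/-- The coefficient of `dt₁⋯dt_ℓ` in the cellular form `ω_σ = ± dt₁⋯dt_ℓ / ∏_i (z_{σ_i} − z_{σ_{i+1}})` (finite factors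
only). [Brown2016, §3.2 (display after Lemma 3.4)] -/
def formDen (σ : Fin (ℓ + 3) → Fin (ℓ + 3)) (t : Fin ℓ → ℝ) : ℝ :=
  ∏ i : Fin (ℓ + 3), ef t (σ i) (σ (i + 1))

/-- The generalised cellular integrand `f_σ(a,b) ω_σ` in simplicial coordinates (coefficient of `dt₁⋯dt_ℓ`):
`num a t / den σ b t / formDen σ t`. [Brown2016, §1.5 (1.4); Def. 5.1 (5.3)] -/
def integrand (σ : Fin (ℓ + 3) → Fin (ℓ + 3)) (a b : Fin (ℓ + 3) → ℤ) (t : Fin ℓ → ℝ) : ℝ :=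
  num a t / den σ b t / formDen σ t

/-- The generalised cellular integral `I_σ(a,b) = ∫_{X_{δ⁰}} f_σ(a,b) ω_σ` as the Bochner integral of `integrand σ a b`
over `openSimplex ℓ` (Mathlib's junk value `0` when the integrand is not integrable). [Brown2016, §1.5 (1.4); (5.3)] -/
def integral (σ : Fin (ℓ + 3) → Fin (ℓ + 3)) (a b : Fin (ℓ + 3) → ℤ) : ℝ :=
  ∫ t in openSimplex ℓ, integrand σ a b t

/-- The basic cellular integrand `f_σ^N ω_σ`: all exponents equal to `N`. [Brown2016, §1.5 (1.3); §5.1 ("setting all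
`a_{i,j}, b_{k,l} = N` … gives back the basic cellular integrals")] -/
def basic (σ : Fin (ℓ + 3) → Fin (ℓ + 3)) (N : ℤ) : (Fin ℓ → ℝ) → ℝ :=
  integrand σ (fun _ => N) (fun _ => N)

/-- Brown's homogeneity equations (5.2): at every vertex `v = σ_i` the two `δ⁰`-edge exponents add up to the two
`σδ⁰`-edge exponents, `a_{σ_i−1,σ_i} + a_{σ_i,σ_i+1} = b_{σ_{i−1},σ_i} + b_{σ_i,σ_{i+1}}` (indices mod `n`); under them the
integrand is `PGL₂`-invariant. [Brown2016, §5.1 eq. (5.2)] -/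
def Homogeneous (σ : Fin (ℓ + 3) → Fin (ℓ + 3)) (a b : Fin (ℓ + 3) → ℤ) : Prop :=
  ∀ i : Fin (ℓ + 3), a (σ i - 1) + a (σ i) = b (i - 1) + b i

/-- `Homogeneous σ a b` is decidable (finitely many integer equations). -/
instance instDecidableHomogeneous (σ : Fin (ℓ + 3) → Fin (ℓ + 3)) (a b : Fin (ℓ + 3) → ℤ) :
    Decidable (Homogeneous σ a b) := by
  unfold Homogeneous; infer_instance

/-- Constant exponents (in particular the basic cellular integrals) are homogeneous for every `σ`. [Brown2016, §5.1] -/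
theorem homogeneous_const (σ : Fin (ℓ + 3) → Fin (ℓ + 3)) (N : ℤ) : Homogeneous σ (fun _ => N) (fun _ => N) :=
  fun _ => rfl

/-- Reading a printed seating plan `(σ(1),…,σ(n))` (a list of the integers `1,…,n`, as in
`Brown2016.DinnerParties`) as a map `Fin n → Fin n`, 0-based: position `i ↦ σ(i+1) − 1`. [Brown2016, §1.5] -/
def ofSeating (s : List ℕ) : Fin (ℓ + 3) → Fin (ℓ + 3) :=
  fun i => ⟨(s.getD i.val 1 - 1) % (ℓ + 3), Nat.mod_lt _ (by omega)⟩

/-! ### Brown's valuation calculus: orders of vanishing along the divisors at finite distance -/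

/-- `c_D(u,v) ∈ {0,1}` for the divisor `D = D_{S|T}`, `S = {p, …, p+k−1} mod n`: `1` if `u, v` lie on the same side of
the chord (`= 2·𝕀_D(u,v)` of [Brown2016, §3.4]), `0` if the chord separates them. [Brown2016, §3.4] -/
def sameSide (p k : ℕ) (u v : Fin (ℓ + 3)) : ℤ :=
  if ((u.val + (ℓ + 3) - p % (ℓ + 3)) % (ℓ + 3) < k ↔ (v.val + (ℓ + 3) - p % (ℓ + 3)) % (ℓ + 3) < k) then 1 else 0

/-- Twice the order of vanishing of the generalised cellular form `f_σ(a,b) ω_σ` along `D_{S|T}`,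
`S = {p,…,p+k−1} mod n`: `2 v_D = Σ_i a_i c_D(i,i+1) − Σ_i (b_i + 1) c_D(σ_i,σ_{i+1}) + (ℓ − 1)`
(= `2·ord_D f_σ(a,b) + 2·ord_D ω_σ` by [Brown2016, eq. (3.8) and Lemma 3.11]). [Brown2016, §3.4, §5.2 proof of Prop. 5.2] -/
def twoOrd (σ : Fin (ℓ + 3) → Fin (ℓ + 3)) (a b : Fin (ℓ + 3) → ℤ) (p k : ℕ) : ℤ :=
  (∑ i : Fin (ℓ + 3), sameSide p k i (i + 1) * a i)
    - (∑ i : Fin (ℓ + 3), sameSide p k (σ i) (σ (i + 1)) * (b i + 1)) + ((ℓ : ℤ) - 1)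

/-- Brown's convergence condition for the generalised cellular integral, in combinatorial form: the form
`f_σ(a,b) ω_σ` has non-negative order of vanishing along every divisor at finite distance with respect to `δ⁰`
(chords `S = {p,…,p+k−1}`, `2 ≤ k ≤ n−2`; here `k = k' + 2`, `k' : Fin ℓ`). [Brown2016, §2.4 (2.3); Def. 5.1] -/
def BrownConvergent (σ : Fin (ℓ + 3) → Fin (ℓ + 3)) (a b : Fin (ℓ + 3) → ℤ) : Prop :=
  ∀ p : Fin (ℓ + 3), ∀ k' : Fin ℓ, 0 ≤ twoOrd σ a b p (k' + 2)

/-- `BrownConvergent σ a b` is decidable (finitely many integer inequalities). -/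
instance instDecidableBrownConvergent (σ : Fin (ℓ + 3) → Fin (ℓ + 3)) (a b : Fin (ℓ + 3) → ℤ) :
    Decidable (BrownConvergent σ a b) := by
  unfold BrownConvergent; infer_instance

/-! ### Positivity on the simplex -/

/-- On the open simplex the marked points increase: `pt t i < pt t j` for `i < j ≤ ℓ + 1`. [Brown2016, §2.3] -/
theorem pt_lt_pt {t : Fin ℓ → ℝ} (ht : t ∈ openSimplex ℓ) {i j : ℕ} (hij : i < j) (hj : j ≤ ℓ + 1) :
    pt t i < pt t j := by
  induction j with
  | zero => exact absurd hij (Nat.not_lt_zero _)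
  | succ j ih =>
    have hstep : pt t j < pt t (j + 1) := by
      have := ht ⟨j, by omega⟩
      simpa using this
    rcases Nat.lt_succ_iff_lt_or_eq.1 hij with h | h
    · exact (ih h (by omega)).trans hstep
    · subst h; exact hstep

/-- Every edge factor is positive on the open simplex (for distinct vertices). [Brown2016, §1.5, §2.3] -/
theorem ef_pos {t : Fin ℓ → ℝ} (ht : t ∈ openSimplex ℓ) {u v : Fin (ℓ + 3)} (huv : u ≠ v) : 0 < ef t u v := by
  unfold ef
  split_ifs with h
  · exact one_pos
  · have hu' : u.val ≠ ℓ + 2 := fun e => h (Or.inl e)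
    have hv' : v.val ≠ ℓ + 2 := fun e => h (Or.inr e)
    have hu : u.val ≤ ℓ + 1 := by have := u.isLt; omega
    have hv : v.val ≤ ℓ + 1 := by have := v.isLt; omega
    have hne : u.val ≠ v.val := fun e => huv (Fin.ext e)
    rcases Nat.lt_or_gt_of_ne hne with hlt | hlt
    · rw [max_eq_right hlt.le, min_eq_left hlt.le]
      exact sub_pos.2 (pt_lt_pt ht hlt hv)
    · rw [max_eq_left hlt.le, min_eq_right hlt.le]
      exact sub_pos.2 (pt_lt_pt ht hlt hu)

/-- In `Fin (ℓ+3)`, `i + 1 ≠ i`. -/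
theorem succ_ne_self (i : Fin (ℓ + 3)) : i ≠ i + 1 := by
  intro h
  have h2 := congrArg Fin.val h
  rw [Fin.val_add_one] at h2
  split_ifs at h2 with h3
  · rw [h3, Fin.val_last] at h2; omega
  · omega

/-- The generalised cellular integrand is positive on the open simplex, for any injective `σ` and any exponents
(the integrals `I_σ(a,b)` are integrals of positive functions). [Brown2016, §1.5] -/
theorem integrand_pos {σ : Fin (ℓ + 3) → Fin (ℓ + 3)} (hσ : Function.Injective σ) (a b : Fin (ℓ + 3) → ℤ)
    {t : Fin ℓ → ℝ} (ht : t ∈ openSimplex ℓ) : 0 < integrand σ a b t := by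
  have h1 : 0 < num a t := Finset.prod_pos fun i _ => zpow_pos (ef_pos ht (succ_ne_self i)) _
  have hσne : ∀ i, σ i ≠ σ (i + 1) := fun i e => succ_ne_self i (hσ e)
  have h2 : 0 < den σ b t := Finset.prod_pos fun i _ => zpow_pos (ef_pos ht (hσne i)) _
  have h3 : 0 < formDen σ t := Finset.prod_pos fun i _ => ef_pos ht (hσne i)
  unfold integrand
  positivity

/-- `pt t k` depends continuously on `t`. -/
theorem continuous_pt (k : ℕ) : Continuous fun t : Fin ℓ → ℝ => pt t k := by
  unfold pt
  split_ifs
  · exact continuous_const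
  · exact continuous_apply _
  · exact continuous_const

/-- The open simplex is open. [Brown2016, §2.3] -/
theorem isOpen_openSimplex (ℓ : ℕ) : IsOpen (openSimplex ℓ) := by
  have : openSimplex ℓ = ⋂ k : Fin (ℓ + 1), {t | pt t k < pt t (k + 1)} := by
    ext t; simp [openSimplex]
  rw [this]
  exact isOpen_iInter_of_finite fun k => isOpen_lt (continuous_pt _) (continuous_pt _)

/-- The open simplex is measurable. -/
theorem measurableSet_openSimplex (ℓ : ℕ) : MeasurableSet (openSimplex ℓ) :=
  (isOpen_openSimplex ℓ).measurableSet

/-- The generalised cellular integral is non-negative (for injective `σ`; it is the integral of a positive function,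
or `0` if that function is not integrable). [Brown2016, §1.5] -/
theorem integral_nonneg {σ : Fin (ℓ + 3) → Fin (ℓ + 3)} (hσ : Function.Injective σ) (a b : Fin (ℓ + 3) → ℤ) :
    0 ≤ integral σ a b :=
  setIntegral_nonneg (measurableSet_openSimplex ℓ) fun _ ht => (integrand_pos hσ a b ht).le

/-- If the integrand is integrable on the simplex, the generalised cellular integral is POSITIVE (non-vanishing of the
forms). [Brown2016, §1.5] -/
theorem integral_pos {σ : Fin (ℓ + 3) → Fin (ℓ + 3)} (hσ : Function.Injective σ) (a b : Fin (ℓ + 3) → ℤ)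
    (hint : IntegrableOn (integrand σ a b) (openSimplex ℓ)) (hℓ : (volume (openSimplex ℓ)) ≠ 0) :
    0 < integral σ a b := by
  unfold integral
  have hnn : 0 ≤ᵐ[volume.restrict (openSimplex ℓ)] integrand σ a b :=
    (ae_restrict_iff' (measurableSet_openSimplex ℓ)).2 (ae_of_all _ fun t ht => (integrand_pos hσ a b ht).le)
  rw [setIntegral_pos_iff_support_of_nonneg_ae hnn hint]
  have : Function.support (integrand σ a b) ∩ openSimplex ℓ = openSimplex ℓ := by
    ext t
    simp only [mem_inter_iff, Function.mem_support, and_iff_right_iff_imp]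
    exact fun ht => (integrand_pos hσ a b ht).ne'
  rw [this]
  exact pos_iff_ne_zero.2 hℓ

/-! ### Elementary algebra of the integrand -/

/-- The basic integrand is `(num/den)`-power form: `basic σ N t = (∏ δ-factors / ∏ σ-factors)^N / ∏ σ-factors`.
[Brown2016, §1.5 (1.3)] -/
theorem basic_eq (σ : Fin (ℓ + 3) → Fin (ℓ + 3)) (N : ℤ) (t : Fin ℓ → ℝ) :
    basic σ N t = ((∏ i : Fin (ℓ + 3), ef t i (i + 1)) / formDen σ t) ^ N / formDen σ t := by
  unfold basic integrand num den formDen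
  rw [div_zpow, Finset.prod_zpow, Finset.prod_zpow]

/-- The two `δ⁰`-edges through the point at infinity contribute trivially: `ef t u v = 1` when `v` is the point at
infinity. -/
theorem ef_infty_right (t : Fin ℓ → ℝ) (u v : Fin (ℓ + 3)) (hv : v.val = ℓ + 2) : ef t u v = 1 := by
  simp [ef, hv]

/-- `ef t u v = 1` when `u` is the point at infinity. -/
theorem ef_infty_left (t : Fin ℓ → ℝ) (u v : Fin (ℓ + 3)) (hu : u.val = ℓ + 2) : ef t u v = 1 := by
  simp [ef, hu]

/-- `ef` is symmetric in the two vertices. -/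
theorem ef_comm (t : Fin ℓ → ℝ) (u v : Fin (ℓ + 3)) : ef t u v = ef t v u := by
  unfold ef
  split_ifs with h1 h2 h2
  · rfl
  · exact absurd (Or.symm h1) h2
  · exact absurd (Or.symm h2) h1
  · rw [max_comm, min_comm]

/-! ### Unfolding devices (bounded quantifiers and sums over `Fin n` as explicit conjunctions / sums) -/

/-- `∀` over `Fin 2` as a conjunction. -/
theorem forall_fin2 (P : Fin 2 → Prop) : (∀ i, P i) ↔ P 0 ∧ P 1 := by
  constructor
  · intro h; exact ⟨h 0, h 1⟩
  · rintro ⟨h0, h1⟩ i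
    fin_cases i <;> assumption

/-- `∀` over `Fin 3` as a conjunction. -/
theorem forall_fin3 (P : Fin 3 → Prop) : (∀ i, P i) ↔ P 0 ∧ P 1 ∧ P 2 := by
  constructor
  · intro h; exact ⟨h 0, h 1, h 2⟩
  · rintro ⟨h0, h1, h2⟩ i
    fin_cases i <;> assumption

/-- `∀` over `Fin 4` as a conjunction. -/
theorem forall_fin4 (P : Fin 4 → Prop) : (∀ i, P i) ↔ P 0 ∧ P 1 ∧ P 2 ∧ P 3 := by
  constructor
  · intro h; exact ⟨h 0, h 1, h 2, h 3⟩
  · rintro ⟨h0, h1, h2, h3⟩ i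
    fin_cases i <;> assumption

/-- `∀` over `Fin 5` as a conjunction. -/
theorem forall_fin5 (P : Fin 5 → Prop) : (∀ i, P i) ↔ P 0 ∧ P 1 ∧ P 2 ∧ P 3 ∧ P 4 := by
  constructor
  · intro h; exact ⟨h 0, h 1, h 2, h 3, h 4⟩
  · rintro ⟨h0, h1, h2, h3, h4⟩ i
    fin_cases i <;> assumption

/-- `∀` over `Fin 6` as a conjunction. -/
theorem forall_fin6 (P : Fin 6 → Prop) : (∀ i, P i) ↔ P 0 ∧ P 1 ∧ P 2 ∧ P 3 ∧ P 4 ∧ P 5 := by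
  constructor
  · intro h; exact ⟨h 0, h 1, h 2, h 3, h 4, h 5⟩
  · rintro ⟨h0, h1, h2, h3, h4, h5⟩ i
    fin_cases i <;> assumption

/-- `∀` over `Fin 7` as a conjunction. -/
theorem forall_fin7 (P : Fin 7 → Prop) : (∀ i, P i) ↔ P 0 ∧ P 1 ∧ P 2 ∧ P 3 ∧ P 4 ∧ P 5 ∧ P 6 := by
  constructor
  · intro h; exact ⟨h 0, h 1, h 2, h 3, h 4, h 5, h 6⟩
  · rintro ⟨h0, h1, h2, h3, h4, h5, h6⟩ i
    fin_cases i <;> assumption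

/-- `∀` over `Fin 8` as a conjunction. -/
theorem forall_fin8 (P : Fin 8 → Prop) : (∀ i, P i) ↔ P 0 ∧ P 1 ∧ P 2 ∧ P 3 ∧ P 4 ∧ P 5 ∧ P 6 ∧ P 7 := by
  constructor
  · intro h; exact ⟨h 0, h 1, h 2, h 3, h 4, h 5, h 6, h 7⟩
  · rintro ⟨h0, h1, h2, h3, h4, h5, h6, h7⟩ i
    fin_cases i <;> assumption

/-- `∀` over `Fin 9` as a conjunction. -/
theorem forall_fin9 (P : Fin 9 → Prop) :
    (∀ i, P i) ↔ P 0 ∧ P 1 ∧ P 2 ∧ P 3 ∧ P 4 ∧ P 5 ∧ P 6 ∧ P 7 ∧ P 8 := by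
  constructor
  · intro h; exact ⟨h 0, h 1, h 2, h 3, h 4, h 5, h 6, h 7, h 8⟩
  · rintro ⟨h0, h1, h2, h3, h4, h5, h6, h7, h8⟩ i
    fin_cases i <;> assumption

/-- `∀` over `Fin 10` as a conjunction. -/
theorem forall_fin10 (P : Fin 10 → Prop) :
    (∀ i, P i) ↔ P 0 ∧ P 1 ∧ P 2 ∧ P 3 ∧ P 4 ∧ P 5 ∧ P 6 ∧ P 7 ∧ P 8 ∧ P 9 := by
  constructor
  · intro h; exact ⟨h 0, h 1, h 2, h 3, h 4, h 5, h 6, h 7, h 8, h 9⟩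
  · rintro ⟨h0, h1, h2, h3, h4, h5, h6, h7, h8, h9⟩ i
    fin_cases i <;> assumption

/-- `∑` over `Fin 9` unrolled (Mathlib stops at `Fin.sum_univ_eight`). -/
theorem sum_fin9 (f : Fin 9 → ℤ) : ∑ i, f i = f 0 + f 1 + f 2 + f 3 + f 4 + f 5 + f 6 + f 7 + f 8 := by
  simp [Fin.sum_univ_succ]
  ring

/-- `∑` over `Fin 10` unrolled. -/
theorem sum_fin10 (f : Fin 10 → ℤ) :
    ∑ i, f i = f 0 + f 1 + f 2 + f 3 + f 4 + f 5 + f 6 + f 7 + f 8 + f 9 := by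
  simp [Fin.sum_univ_succ]
  ring

/-- `∏` over `Fin 9` unrolled (Mathlib stops at `Fin.prod_univ_eight`). -/
theorem prod_fin9 (f : Fin 9 → ℝ) : ∏ i, f i = f 0 * f 1 * f 2 * f 3 * f 4 * f 5 * f 6 * f 7 * f 8 := by
  simp [Fin.prod_univ_succ]
  ring

/-- `∏` over `Fin 10` unrolled. -/
theorem prod_fin10 (f : Fin 10 → ℝ) :
    ∏ i, f i = f 0 * f 1 * f 2 * f 3 * f 4 * f 5 * f 6 * f 7 * f 8 * f 9 := by
  simp [Fin.prod_univ_succ]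
  ring

end Summit.KontsevichZagierPeriods.Zeta5Search.Families.Cellular
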